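import Mathlib.Algebra.Polynomial.AlgebraMap
import Mathlib.Algebra.Polynomial.Degree.Lemmas
import Mathlib.LinearAlgebra.Span.Basic

/-!
# Polynomials in a level-raising operator cannot reach the last time level (DEQ-A146 support)

HONEST FRAMING: instance-level adjudication of specific advantage claims; no claim about
BQP vs BPP or the summit.

Bharadwaj–Sreenivasan (Phys. Rev. Research 7, 023262 (2025) = arXiv:2405.09767v3, §III.B and
App. A–B) propose "one-shot" quantum solvers for `u^{t+1} = A u^t`: all time levels are stacked into
one history vector, the block lower-bidiagonal system `A_EO 𝐮 = 𝐛` with `A_EO = I − 𝒩`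
(`𝒩` = block sub-diagonal carrying `A`, `𝐛 = e₀ ⊗ u_in`, their eq. (A14)) is inverted by a
truncated Neumann series `Σ_{p<P} 𝒩^p`, and the truncation order is claimed to be
`P = O(log(1/ε)/log(1/(κ−1)))` from `‖I − A_EO‖ < 1` (their App. B, (B10)–(B12)).
DEQ-A146 (Theorem A146-B(ii)) observes that `𝒩` raises the time level by exactly one, so that ANY
polynomial of degree `< T − 1` in `𝒩` — equivalently in `A_EO = I − 𝒩` — applied to `𝐛` has last
block zero, whence `P_min = T = τ + c + 1` terms are necessary (and, `𝒩` being nilpotent of index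
`T`, sufficient): the truncated Neumann series is explicit time stepping stopped after `P` levels.

This file records the structural half of that statement with no `sorry`, in two layers.
(1) Abstractly (`aeval_apply_mem`, `aeval_one_sub_apply_mem`): if `F : ℕ → Submodule R M` is a
monotone filtration and a linear map `N` sends `F t` into `F (t+1)`, then for every polynomial `q`
and every `x ∈ F 0`, both `q(N) x` and `q(1 − N) x` lie in `F (natDegree q)`.
(2) Concretely (`aeval_blockShift_bvec_last`, `aeval_one_sub_blockShift_bvec_last`): on histories
`Fin (n+1) → V` with the block down-shift `blockShift B` (`(𝒩 v)_s = B_s v_{s−1}`, `(𝒩 v)_0 = 0`,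
arbitrary blockwise linear maps `B_s`, covering the paper's `A_EO` with `B_s = A` for `s ≤ τ` and
`B_s = id` afterwards) and the source `bvec u₀ = e₀ ⊗ u₀`, every polynomial of degree `< n` in `𝒩`
or in `1 − 𝒩` applied to `bvec u₀` vanishes at the last level `Fin.last n`.  With `n = τ + c` this
is `P_min ≥ τ + c + 1` for the partial sums `Σ_{p<P} 𝒩^p 𝐛` (degree `P − 1`).  Sharpness of
the degree bound is recorded in the transport instance `B_s = id`
(`blockShift_id_pow_bvec_last`: `𝒩^n 𝐛` equals `u₀` at the last level); the general tightness
facts (`𝒩^{T−1} 𝐛 ≠ 0` for the paper's `A_E`, `‖𝒩‖₂ = 1`, `κ₂(A_EO) > 2`) are elementary and are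
certified numerically in NUMERICS-A146 (checks C-A146-6/7), not formalised here.  Only
`Polynomial.aeval` and `Submodule` algebra from Mathlib are used. [folklore]
-/

namespace Summit.QuantumAdvantage.Dequantization.NilpotentNeumannTruncation

open Polynomial

section Abstract

variable {R M : Type*} [CommRing R] [AddCommGroup M] [Module R M]

/-- Iterates of a level-raising map: if `N (F t) ⊆ F (t+1)` for all `t` and `x ∈ F 0`, then
`N^i x ∈ F i`. [folklore] -/
theorem pow_apply_mem (N : M →ₗ[R] M) (F : ℕ → Submodule R M)
    (hN : ∀ t, ∀ v ∈ F t, N v ∈ F (t + 1)) {x : M} (hx : x ∈ F 0) (i : ℕ) :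
    (N ^ i) x ∈ F i := by
  induction i with
  | zero => simpa using hx
  | succ i ih =>
    rw [pow_succ', Module.End.mul_apply]
    exact hN i _ ih

/-- A polynomial of degree `d` in a level-raising map sends `F 0` into `F d`
(monotone filtration). [folklore] -/
theorem aeval_apply_mem (N : M →ₗ[R] M) (F : ℕ → Submodule R M) (hF : Monotone F)
    (hN : ∀ t, ∀ v ∈ F t, N v ∈ F (t + 1)) {x : M} (hx : x ∈ F 0) (q : R[X]) :
    aeval N q x ∈ F q.natDegree := by
  rw [aeval_eq_sum_range, LinearMap.sum_apply]
  refine Submodule.sum_mem _ fun i hi => ?_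
  rw [LinearMap.smul_apply]
  exact Submodule.smul_mem _ _
    (hF (Nat.lt_succ_iff.mp (Finset.mem_range.mp hi)) (pow_apply_mem N F hN hx i))

/-- The same for polynomials in the unipotent operator `1 − N` (the paper's `A_EO = I − 𝒩`):
`q(1 − N) = (q ∘ (1 − X))(N)` has the same degree bound. [folklore] -/
theorem aeval_one_sub_apply_mem (N : M →ₗ[R] M) (F : ℕ → Submodule R M) (hF : Monotone F)
    (hN : ∀ t, ∀ v ∈ F t, N v ∈ F (t + 1)) {x : M} (hx : x ∈ F 0) (q : R[X]) :
    aeval (1 - N) q x ∈ F q.natDegree := by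
  have h1 : aeval N (1 - X : R[X]) = 1 - N := by
    rw [map_sub, map_one, aeval_X]
  have h2 : aeval (1 - N) q = aeval N (q.comp (1 - X)) := by
    rw [aeval_comp, h1]
  rw [h2]
  refine hF ?_ (aeval_apply_mem N F hF hN hx _)
  calc (q.comp (1 - X)).natDegree ≤ q.natDegree * (1 - X : R[X]).natDegree := natDegree_comp_le
    _ ≤ q.natDegree * 1 := Nat.mul_le_mul_left _
        ((natDegree_sub_le _ _).trans (max_le (by simp) natDegree_X_le))
    _ = q.natDegree := mul_one _

/-- Contrapositive form used in DEQ-A146 Theorem A146-B(ii): a target outside `F d` is not the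
value of any polynomial of degree `≤ d` in `N` or in `1 − N` applied to `x ∈ F 0`. [folklore] -/
theorem aeval_apply_ne_of_not_mem (N : M →ₗ[R] M) (F : ℕ → Submodule R M) (hF : Monotone F)
    (hN : ∀ t, ∀ v ∈ F t, N v ∈ F (t + 1)) {x y : M} (hx : x ∈ F 0) {d : ℕ} (hy : y ∉ F d)
    (q : R[X]) (hq : q.natDegree ≤ d) :
    aeval N q x ≠ y ∧ aeval (1 - N) q x ≠ y := by
  refine ⟨fun h => hy ?_, fun h => hy ?_⟩
  · exact h ▸ hF hq (aeval_apply_mem N F hF hN hx q)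
  · exact h ▸ hF hq (aeval_one_sub_apply_mem N F hF hN hx q)

end Abstract

section Histories

variable {R V : Type*} [CommRing R] [AddCommGroup V] [Module R V] {n : ℕ}

/-- Histories `Fin (n+1) → V` supported on the time levels `≤ t`. -/
def suppLE (R V : Type*) [CommRing R] [AddCommGroup V] [Module R V] (n t : ℕ) :
    Submodule R (Fin (n + 1) → V) where
  carrier := {v | ∀ s : Fin (n + 1), t < s.val → v s = 0}
  zero_mem' := fun _ _ => rfl
  add_mem' := by
    intro v w hv hw s hs
    simp only [Pi.add_apply, hv s hs, hw s hs, add_zero]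
  smul_mem' := by
    intro c v hv s hs
    simp only [Pi.smul_apply, hv s hs, smul_zero]

/-- Membership in the support filtration: `v ∈ suppLE t` iff `v` vanishes above level `t`.
[folklore] -/
theorem mem_suppLE {t : ℕ} {v : Fin (n + 1) → V} :
    v ∈ suppLE R V n t ↔ ∀ s : Fin (n + 1), t < s.val → v s = 0 := Iff.rfl

/-- The support filtration is monotone in the level. [folklore] -/
theorem suppLE_monotone : Monotone (suppLE R V n) := by
  intro t t' htt' v hv s hs
  exact hv s (lt_of_le_of_lt htt' hs)

/-- The block down-shift `𝒩`: `(𝒩 v)_s = B_s (v_{s-1})` for `s ≥ 1`, `(𝒩 v)_0 = 0`, with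
arbitrary blockwise linear maps `B_s` (the paper's `A_EO = I − 𝒩` has `B_s = A_E` for `s ≤ τ`
and `B_s = id` for the `c` idle levels). -/
def blockShift (B : Fin (n + 1) → (V →ₗ[R] V)) : (Fin (n + 1) → V) →ₗ[R] (Fin (n + 1) → V) where
  toFun v s := if s.val = 0 then 0 else B s (v ⟨s.val - 1, by have := s.isLt; omega⟩)
  map_add' v w := by
    funext s
    simp only [Pi.add_apply]
    split_ifs with h
    · exact (add_zero _).symm
    · rw [map_add]
  map_smul' c v := by
    funext s
    simp only [Pi.smul_apply, RingHom.id_apply]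
    split_ifs with h
    · exact (smul_zero c).symm
    · rw [map_smul]

/-- Componentwise formula for the block down-shift `𝒩`. [folklore] -/
theorem blockShift_apply (B : Fin (n + 1) → (V →ₗ[R] V)) (v : Fin (n + 1) → V) (s : Fin (n + 1)) :
    blockShift B v s = if s.val = 0 then 0 else B s (v ⟨s.val - 1, by have := s.isLt; omega⟩) :=
  rfl

/-- `𝒩` raises the support by exactly one level. -/
theorem blockShift_mem_suppLE (B : Fin (n + 1) → (V →ₗ[R] V)) (t : ℕ)
    (v : Fin (n + 1) → V) (hv : v ∈ suppLE R V n t) :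
    blockShift B v ∈ suppLE R V n (t + 1) := by
  intro s hs
  rw [blockShift_apply]
  by_cases h : s.val = 0
  · rw [if_pos h]
  · rw [if_neg h]
    have hz : v ⟨s.val - 1, by have := s.isLt; omega⟩ = 0 := hv _ (by simp only; omega)
    rw [hz, map_zero]

/-- The source `𝐛 = e₀ ⊗ u₀`: `u₀` at level `0`, zero elsewhere. -/
def bvec (n : ℕ) (u₀ : V) : Fin (n + 1) → V := fun s => if s.val = 0 then u₀ else 0

/-- The source `e₀ ⊗ u₀` is supported at level `0`. [folklore] -/
theorem bvec_mem_suppLE (u₀ : V) : bvec n u₀ ∈ suppLE R V n 0 := by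
  intro s hs
  simp only [bvec]
  rw [if_neg (Nat.pos_iff_ne_zero.mp hs)]

/-- **Theorem A146-B(ii) of DEQ-A146, Neumann form.**  Every polynomial of degree `< n` in the
block down-shift — in particular the truncated Neumann series `Σ_{p<P} 𝒩^p` with `P ≤ n` —
applied to `𝐛 = e₀ ⊗ u₀` vanishes at the last time level: `P_min ≥ n + 1 = τ + c + 1` terms are
needed to produce the last block at all. [folklore] -/
theorem aeval_blockShift_bvec_last (B : Fin (n + 1) → (V →ₗ[R] V)) (u₀ : V) (q : R[X])
    (hq : q.natDegree < n) :
    aeval (blockShift B) q (bvec n u₀) (Fin.last n) = 0 :=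
  (aeval_apply_mem (blockShift B) (suppLE R V n) suppLE_monotone (blockShift_mem_suppLE B)
    (bvec_mem_suppLE u₀) q) (Fin.last n) (by simpa using hq)

/-- **Theorem A146-B(ii) of DEQ-A146, `A_EO` form.**  The same for polynomials in the unipotent
one-shot matrix `A_EO = 1 − 𝒩` itself (any Krylov / polynomial method in `A_EO` of degree `< n`
misses the last time level). [folklore] -/
theorem aeval_one_sub_blockShift_bvec_last (B : Fin (n + 1) → (V →ₗ[R] V)) (u₀ : V) (q : R[X])
    (hq : q.natDegree < n) :
    aeval (1 - blockShift B) q (bvec n u₀) (Fin.last n) = 0 :=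
  (aeval_one_sub_apply_mem (blockShift B) (suppLE R V n) suppLE_monotone
    (blockShift_mem_suppLE B) (bvec_mem_suppLE u₀) q) (Fin.last n) (by simpa using hq)

/-- Sharpness of the degree bound in the simplest instance (all blocks the identity, i.e. `A = I`,
pure transport of `u₀` down the levels): the `k`-th power of the shift puts `u₀` exactly at level
`k`, so `𝒩^n 𝐛` is `u₀ ≠ 0` at the last level — degree `n` (that is, `P = n + 1 = τ + c + 1`
Neumann terms) is needed AND sufficient there.  The general tightness statement (`‖𝒩‖₂ = 1`,
index exactly `T`) is certified numerically in NUMERICS-A146. [folklore] -/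
theorem blockShift_id_pow_bvec (u₀ : V) :
    ∀ k, k ≤ n → ∀ s : Fin (n + 1),
      ((blockShift (fun _ : Fin (n + 1) => (LinearMap.id : V →ₗ[R] V))) ^ k) (bvec n u₀) s
        = if s.val = k then u₀ else 0 := by
  intro k
  induction k with
  | zero =>
    intro _ s
    rw [pow_zero, Module.End.one_apply]
    rfl
  | succ k ih =>
    intro hk s
    rw [pow_succ', Module.End.mul_apply, blockShift_apply]
    by_cases h : s.val = 0
    · rw [if_pos h, if_neg (by omega)]
    · rw [if_neg h, ih (Nat.le_of_succ_le hk)]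
      simp only [LinearMap.id_coe, id_eq]
      by_cases h2 : s.val = k + 1
      · rw [if_pos h2, if_pos (by omega)]
      · rw [if_neg h2, if_neg (by omega)]

/-- Sharpness in the transport instance `B_s = id`: `𝒩^n (e₀ ⊗ u₀)` carries `u₀` at the last
level. [folklore] -/
theorem blockShift_id_pow_bvec_last (u₀ : V) :
    ((blockShift (fun _ : Fin (n + 1) => (LinearMap.id : V →ₗ[R] V))) ^ n) (bvec n u₀) (Fin.last n)
      = u₀ := by
  rw [blockShift_id_pow_bvec u₀ n le_rfl, if_pos (Fin.val_last n)]

end Histories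

end Summit.QuantumAdvantage.Dequantization.NilpotentNeumannTruncation
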